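import Summits.KontsevichZagierPeriods.Zeta5Search.LaiSweepShard

/-!
# `κ₃` sweep certificate — shard file 000 of 127 (shards 0–6 of 889)

HONEST FRAMING. Systematic search; no irrationality claim unless certified. This file only checks,
by `decide +kernel`, shards 0–6 of the order-cell sweep of the `κ₃` point `(74, 2180, 444; δ74)`
(engine `LaiSweepEngine`, soundness `LaiSweepJump/Free/Eval/Shard/Kappa3`; a shard is `⟨regime, n,
p, q, p', q', Lo, Up⟩`: `n` cells from `p/q` to `p'/q'` with integer rate sums in `[Lo, Up]`, `K =
128`, `D = 2^40`). It draws NO conclusion: only the capstone `LaiKappa3SweepCert`, which needs all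
127 shard files, does. Kernel cost of this file ≈ 560 cells × 0.3 s.
-/

namespace Summit.KontsevichZagierPeriods.Zeta5Search.Sweep

set_option maxHeartbeats 100000000 in
/-- Shard 0: 80 cells of regime A from `1/434` to `1/388`.
[cite: Lai2024BallRivoal, §4 Lemma 4.3] -/
theorem shard000 :
    Shard.check 128 (2^40)
      ⟨false, 80, 1, 434, 1, 388, 1616664475356361, 1619927365068843⟩ = true := by
  decide +kernel

set_option maxHeartbeats 100000000 in
/-- Shard 1: 80 cells of regime A from `1/388` to `3/1103`.
[cite: Lai2024BallRivoal, §4 Lemma 4.3] -/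
theorem shard001 :
    Shard.check 128 (2^40)
      ⟨false, 80, 1, 388, 3, 1103, 1023149567566530, 1024319946586404⟩ = true := by
  decide +kernel

set_option maxHeartbeats 100000000 in
/-- Shard 2: 80 cells of regime A from `3/1103` to `1/334`.
[cite: Lai2024BallRivoal, §4 Lemma 4.3] -/
theorem shard002 :
    Shard.check 128 (2^40)
      ⟨false, 80, 3, 1103, 1, 334, 1654970156785259, 1658586289725507⟩ = true := by
  decide +kernel

set_option maxHeartbeats 100000000 in
/-- Shard 3: 80 cells of regime A from `1/334` to `7/2230`.
[cite: Lai2024BallRivoal, §4 Lemma 4.3] -/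
theorem shard003 :
    Shard.check 128 (2^40)
      ⟨false, 80, 1, 334, 7, 2230, 655926319450100, 656869710329924⟩ = true := by
  decide +kernel

set_option maxHeartbeats 100000000 in
/-- Shard 4: 80 cells of regime A from `7/2230` to `3/871`.
[cite: Lai2024BallRivoal, §4 Lemma 4.3] -/
theorem shard004 :
    Shard.check 128 (2^40)
      ⟨false, 80, 7, 2230, 3, 871, 1085917701093608, 1088532444820169⟩ = true := by
  decide +kernel

set_option maxHeartbeats 100000000 in
/-- Shard 5: 80 cells of regime A from `3/871` to `9/2518`.
[cite: Lai2024BallRivoal, §4 Lemma 4.3] -/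
theorem shard005 :
    Shard.check 128 (2^40)
      ⟨false, 80, 3, 871, 9, 2518, 353963602775680, 354168423810285⟩ = true := by
  decide +kernel

set_option maxHeartbeats 100000000 in
/-- Shard 6: 80 cells of regime A from `9/2518` to `1/259`.
[cite: Lai2024BallRivoal, §4 Lemma 4.3] -/
theorem shard006 :
    Shard.check 128 (2^40)
      ⟨false, 80, 9, 2518, 1, 259, 647443610067117, 648775555606800⟩ = true := by
  decide +kernel

/-- The checked shards of this file, in order. [folklore] -/
def shards000 : List (CheckedShard 128 (2^40)) :=
  [⟨_, shard000⟩, ⟨_, shard001⟩, ⟨_, shard002⟩, ⟨_, shard003⟩, ⟨_, shard004⟩,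
    ⟨_, shard005⟩, ⟨_, shard006⟩]

end Summit.KontsevichZagierPeriods.Zeta5Search.Sweep
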